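import Literature.MathematicalPhysics.QuantumFieldTheory.Balaban1983to89.B1Eq338Rescaling
import Literature.MathematicalPhysics.QuantumFieldTheory.Balaban1983to89.B1Sect3Statements

/-!
# `Balaban1983to89.B1Eq338Display` — T. Bałaban, *(Higgs)₂,₃ quantum fields in a finite volume. I. A lower bound*,
Commun. Math. Phys. **85** (1982) 603–626 [Balaban1982Higgs1]: **(3.38)** p. 619 — the `(k+1)`-st step integral of
(3.37) after the rescaling to the unit lattice, the DISPLAY AS PRINTED over the (Higgs)₂,₃ carriers, PROVED equal to the
integrand of (3.37) at rescaled block fields when the k-th action has the printed form (3.30) (the rescaling itself —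
kernel algebra, invariance of the bracket, Jacobian — is the sibling module `…B1Eq338Rescaling`)

statement-level skeleton of published theorems with citation tags; proofs where landed; nothing here is a claim about the Yang–Mills mass gap

PDF held: `paper:balaban1982-cmp85-higgs23-i` (journal page = PDF page + 602).  (3.30) p. 617 and (3.37)–(3.40)
pp. 618–619 READ AS IMAGES on the ×2 renders `run/shared/lean/pub/pub-balaban/b2b-balaban-ref1/pages/1982-cmp85-higgs23-I/
1982-cmp85-higgs23-I-p015-x2.png`, `…-p016-x2.png`, `…-p017-x2.png`, never from the OCR layer.

CITATION HEADER (lean-in-tree rule).  lit-balaban typed skeleton (HOME `run/shared/lean/pub/lit-balaban/`), SKELETON row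
**B1.Eq3.37–3.38**, the (3.38) member (reader r12 `lit-balaban-r12/ROWS-B1-part2.md` v4.8.1: «(3.37) member PROVED
p245328 (`B1Ineq337Proof.ineq337`; model instance `B1Ineq337HiggsModel` p247729); (3.38) member absent»).  WHAT IS
REPRODUCED, verbatim, p. 619 top [PDF 17]: *"After the rescaling the integral transforms into the integral
const χ_{k+1}(B)χ_{k+1}(ψ) ∫dA∫dφ χ_k(A)χ_k(φ) exp[−½aL^{d−2} Σ_{y∈T_L^{(k+1)}} |B(y) − (QA)(y)|²
− ½aL^{d−2} Σ_{y∈T_L^{(k+1)}} |ψ(y) − (Q(A^{(k)})φ)(y)|² − ½⟨A, Δ^{(k)}A⟩ − ½⟨φ, Δ^{(k)}(A^{(k)})φ⟩ + log Z_k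
+ log Z_k(A^{(k)}) + 𝒫^{(k)}(A^{(k)}, φ) − E₀], (3.38) where now"* (3.39), (3.40) [= row B1.Eq3.39–3.40, p12's
`B1GaussNorm339`: the NUMBERS `log Z_k`, `log Z_k(A^{(k)})` rewritten in unit-lattice variables — they pass through the
present identity unchanged; linking `logZkA` below to `B1GaussNorm339.ZAeta` is that row's reading].  The form of the
k-th action being rescaled, (3.30) p. 617: *"S^{(k),L^kε}(A, φ) = −log Z_k − log Z_k(A^{(k),ε}) + ½⟨A, Δ^{(k),L^kε}A⟩ +
½⟨φ, Δ^{(k),L^kε}(A^{(k),ε})φ⟩ − 𝒫^{(k),L^kε}(A^{(k),ε}, φ) + E₀"* = r12's schematic `B1Sect3Statements.action330` (used BY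
NAME; its six constituents are the arguments `logZk`, `logZkA`, `formA`, `formφ`, `Pk`, `E₀` below, as functions of the
fields through the background `A^{(k),ε} = ext A`).

DICTIONARY (as in `…B1Eq338Rescaling`): `T^{L^kε}_{a,L}[T^{L^kε}_{a,L,Ã(A)}[ρ]]` = `HiggsDoubleRT.doubleRTk`; the unit
lattice = `P.scaleBy (unitScale P k)` (spacing `1` at level `k`, `L` at level `k+1`: the `T_L^{(k+1)}` of the display);
(1.22) = `rescaleVec`/`rescaleScalar`, `σ = (L^kε)^{−(d−2)/2}`; *"rescaling of … the propagators"* (p. 618) = the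
constituents `Δ^{(k),L^kε}`, `Δ^{(k),L^kε}(·)`, `Z_k(·)`, `𝒫^{(k),L^kε}` and the background assignment `A ↦ A^{(k),ε}` are
replaced by their PULLBACKS under (1.22) — the `Δ^{(k)}`, `Z_k(A^{(k)})`, `𝒫^{(k)}`, `A ↦ A^{(k)}` (no superscript) of
(3.38); the background is conjugated (`B1Eq338Rescaling.extRescale`); the charge becomes `e(L^kε)^{(4−d)/2}` (p. 607,
`ChargeData.scaleBy`; cf. the dimensionless charge `e(L^kε)^{(4−d)/2}` of (3.14) p. 614).

WHAT THIS FILE PROVES (0 `sorry`; standard axioms): `stepExponent_unit_330` — on a lattice with spacing `1` at level `k`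
and with `S` of the form (3.30) the bracket `B1Eq338Rescaling.stepExponent` is LITERALLY the printed one (precision
`aL^{d−2}`); `display338` — the right side of (3.38) as a function of the unit-lattice block fields; **`eq338_general`** —
(3.37) ↦ (3.38) for an arbitrary action; **`eq338`** — for `S^{(k),L^kε}` of the form (3.30):
`χ_{k+1}(B)χ_{k+1}(ψ)·T^{L^kε}_{a,L}[T^{L^kε}_{a,L,A^{(k),ε}}[χ_kχ_k e^{−S^{(k)}}]](σB′, σψ′) = display338(B′, ψ′)` with
`const = B1Eq338Rescaling.rescaleConstK` and the pulled-back weights/constituents; **`integral337_eq_integral338`** — the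
whole `dB dψ`-integral of (3.37) equals `σ^{|bonds|+N|sites| of T^{(k+1)}}` times the `dB′dψ′`-integral of (3.38).
HONEST SCOPE.  (i) The constituents of (3.30) and the background assignment are ARGUMENTS (rows B1.Eq3.29–3.32/3.36 type
them schematically; the operators `G_k`, `Δ^{(k)}` of Sect. 2 are not constructed at level `k` in the tree), so (3.38) is
proved for every such datum — in particular the printed one; identifying the pulled-back forms with the unit-lattice
operators of (2.22)/(3.39)–(3.40) (e.g. `M_η = (L^kε)²M_ε` in p12's `B1GaussNorm339.eq339`) is those rows' business.
(ii) Convergence of the integrals is not part of the display and is neither used nor asserted.  (iii) Nothing here bears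
on (3.41) ff.
Unit `lit-balaban-p14` gen 5 (Phase-2 proof seat p14, literature-prover-lit-balaban-p14-g5-0), HOME
`run/shared/lean/pub/lit-balaban/` (seat log `lit-balaban-p14/STATUS.md`).
-/

open scoped BigOperators
open _root_.MeasureTheory _root_.Real

namespace Literature.MathematicalPhysics.QuantumFieldTheory.Balaban1983to89.B1Eq338Display

open Literature.MathematicalPhysics.QuantumFieldTheory.Balaban1983to89.HiggsLattice
open Literature.MathematicalPhysics.QuantumFieldTheory.Balaban1983to89.HiggsAveraging
open Literature.MathematicalPhysics.QuantumFieldTheory.Balaban1983to89.HiggsRescaling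
open Literature.MathematicalPhysics.QuantumFieldTheory.Balaban1983to89.HiggsDoubleRT
open Literature.MathematicalPhysics.QuantumFieldTheory.Balaban1983to89.B2Eq21FirstStep
open Literature.MathematicalPhysics.QuantumFieldTheory.Balaban1983to89.B3MultiscaleFields (toSite zeroCharge)
open Literature.MathematicalPhysics.QuantumFieldTheory.Balaban1983to89.B1Sect3Statements (action330)
open Literature.MathematicalPhysics.QuantumFieldTheory.Balaban1983to89.B1Eq338Rescaling

variable {P : Params}

/-! ## (3.38) -/

section Display338

variable {k N : ℕ}

/-- On a lattice whose level `k` has spacing `1` (the unit lattice `T^{(k)}_1`; block spacing `L`), with the action of the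
form (3.30) — `S(A, φ) = −log Z_k − log Z_k(A^{(k)}) + ½⟨A, Δ^{(k)}A⟩ + ½⟨φ, Δ^{(k)}(A^{(k)})φ⟩ − 𝒫^{(k)}(A^{(k)}, φ) + E₀`
(`B1Sect3Statements.action330`, constituents as functions of the fields through the background `A^{(k)} = bg A`) — the
bracket is LITERALLY the one printed in (3.38):
`−½aL^{d−2}Σ_y|B(y)−(QA)(y)|² − ½aL^{d−2}Σ_y|ψ(y)−(Q(A^{(k)})φ)(y)|² − ½⟨A,Δ^{(k)}A⟩ − ½⟨φ,Δ^{(k)}(A^{(k)})φ⟩ + log Z_k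
+ log Z_k(A^{(k)}) + 𝒫^{(k)}(A^{(k)},φ) − E₀`. PROVED. [cite: Balaban1982Higgs1, (3.38) p.619] -/
theorem stepExponent_unit_330 {P₁ : Params} (h1 : P₁.mesh k = 1) (C₁ : ChargeData N) (a : ℝ)
    (bg : VecField P₁ k → VecField P₁ 0) {S : VecField P₁ k → ScalarField P₁ k N → ℝ} {logZk E₀ : ℝ}
    {logZkA : VecField P₁ 0 → ℝ} {formA : VecField P₁ k → ℝ} {formφ Pk : VecField P₁ 0 → ScalarField P₁ k N → ℝ}
    (hS : ∀ A φ, S A φ = action330 logZk (logZkA (bg A)) (formA A) (formφ (bg A) φ) (Pk (bg A) φ) E₀)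
    (B : VecField P₁ (k + 1)) (ψ : ScalarField P₁ (k + 1) N) (A : VecField P₁ k) (φ : ScalarField P₁ k N) :
    stepExponent C₁ a bg S B ψ A φ
      = -(a * (P₁.L : ℝ) ^ ((P₁.d : ℤ) - 2) / 2) * ∑ y : Site P₁ (k + 1), ‖toSite B y - linAvg (toSite A) y‖ ^ 2
        - a * (P₁.L : ℝ) ^ ((P₁.d : ℤ) - 2) / 2 * ∑ y : Site P₁ (k + 1), ‖ψ y - avgQ C₁ (bg A) φ y‖ ^ 2
        - 1 / 2 * formA A - 1 / 2 * formφ (bg A) φ + logZk + logZkA (bg A) + Pk (bg A) φ - E₀ := by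
  have hL : P₁.mesh (k + 1) = P₁.L := by rw [mesh_succ, h1, mul_one]
  unfold stepExponent
  rw [hS, hL, B1RT.prec_eq, action330]
  ring

/-- **(3.38) p. 619 [PDF 17]**, verbatim: *"After the rescaling the integral transforms into the integral
const χ_{k+1}(B)χ_{k+1}(ψ) ∫dA∫dφ χ_k(A)χ_k(φ) exp[−½aL^{d−2} Σ_{y∈T_L^{(k+1)}} |B(y) − (QA)(y)|²
− ½aL^{d−2} Σ_{y∈T_L^{(k+1)}} |ψ(y) − (Q(A^{(k)})φ)(y)|² − ½⟨A, Δ^{(k)}A⟩ − ½⟨φ, Δ^{(k)}(A^{(k)})φ⟩ + log Z_k + log Z_k(A^{(k)})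
+ 𝒫^{(k)}(A^{(k)}, φ) − E₀], (3.38)"* — typed reading: a function of the block fields `B, ψ` of the unit-lattice family `P₁`
(level `k+1`, spacing `L`), the integral over the unit-lattice fields `A, φ` (level `k`; iterated Lebesgue integrals,
p. 605); `QA` the plain and `Q(A^{(k)})φ` the covariant block average (2.7) at the rescaled background `A^{(k)} = bg A`
and charge `C₁`; the constituents of (3.30) after the rescaling — `⟨A, Δ^{(k)}A⟩ = formA A`, `⟨φ, Δ^{(k)}(A^{(k)})φ⟩ =
formφ (bg A) φ`, `log Z_k`, `log Z_k(A^{(k)}) = logZkA (bg A)` ((3.39)–(3.40), row B1.Eq3.39–3.40), `𝒫^{(k)}`, `E₀` —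
and the weights `χ_{k+1}`, `χ_k` as arguments; `const` explicit.  Convergence is not part of the display.
[cite: Balaban1982Higgs1, (3.38) p.619] -/
noncomputable def display338 (P₁ : Params) (k : ℕ) (C₁ : ChargeData N) (a const : ℝ)
    (χk1 : VecField P₁ (k + 1) → ScalarField P₁ (k + 1) N → ℝ) (χk : VecField P₁ k → ScalarField P₁ k N → ℝ)
    (bg : VecField P₁ k → VecField P₁ 0) (logZk : ℝ) (logZkA : VecField P₁ 0 → ℝ) (formA : VecField P₁ k → ℝ)
    (formφ Pk : VecField P₁ 0 → ScalarField P₁ k N → ℝ) (E₀ : ℝ)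
    (B : VecField P₁ (k + 1)) (ψ : ScalarField P₁ (k + 1) N) : ℝ :=
  const * χk1 B ψ
    * ∫ A : VecField P₁ k, ∫ φ : ScalarField P₁ k N, χk A φ
        * Real.exp (-(a * (P₁.L : ℝ) ^ ((P₁.d : ℤ) - 2) / 2) * ∑ y : Site P₁ (k + 1), ‖toSite B y - linAvg (toSite A) y‖ ^ 2
            - a * (P₁.L : ℝ) ^ ((P₁.d : ℤ) - 2) / 2 * ∑ y : Site P₁ (k + 1), ‖ψ y - avgQ C₁ (bg A) φ y‖ ^ 2
            - 1 / 2 * formA A - 1 / 2 * formφ (bg A) φ + logZk + logZkA (bg A) + Pk (bg A) φ - E₀)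

/-- **(3.37) ↦ (3.38) for an arbitrary action** (the sentence p. 618–619 at `s = (L^kε)⁻¹`, before the form (3.30) is
inserted): for every outer weight `χ′` (↤ `χ_{k+1}(B)χ_{k+1}(ψ)`), inner weight `χ` (↤ `χ_k(A)χ_k(φ)`), action `S` and
background assignment `Ã`, at the rescalings `(B, ψ) = (σB′, σψ′)` of unit-lattice block fields,
`χ′(B,ψ)·T^{L^kε}_{a,L}[T^{L^kε}_{a,L,Ã(A)}[χe^{−S}]](B,ψ) = const·χ′₁(B′,ψ′)·∫dA′∫dφ′ χ₁(A′,φ′) exp[−½aL^{d−2}Σ|B′−QA′|²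
− ½aL^{d−2}Σ|ψ′−Q(Ã₁(A′))φ′|² − S₁(A′,φ′)]` with the pulled-back weights/action, the conjugated background `Ã₁ = extRescale`,
the rescaled charge and `const = rescaleConstK`. PROVED. [cite: Balaban1982Higgs1, (3.38) p.619] -/
theorem eq338_general (C : ChargeData N) (a : ℝ) (ext : VecField P k → VecField P 0)
    (χ' : VecField P (k + 1) → ScalarField P (k + 1) N → ℝ) (χ : VecField P k → ScalarField P k N → ℝ)
    (S : VecField P k → ScalarField P k N → ℝ)
    (B' : VecField (P.scaleBy (unitScale P k) (unitScale_pos P k)) (k + 1))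
    (ψ' : ScalarField (P.scaleBy (unitScale P k) (unitScale_pos P k)) (k + 1) N) :
    χ' (rescaleVec (unitScale_pos P k) B') (rescaleScalar (unitScale_pos P k) ψ')
        * doubleRTk C a ext (fun A φ => χ A φ * Real.exp (-S A φ))
            (rescaleVec (unitScale_pos P k) B') (rescaleScalar (unitScale_pos P k) ψ')
      = rescaleConstK P k N a (unitScale P k)
          * χ' (rescaleVec (unitScale_pos P k) B') (rescaleScalar (unitScale_pos P k) ψ')
          * ∫ A' : VecField (P.scaleBy (unitScale P k) (unitScale_pos P k)) k,
              ∫ φ' : ScalarField (P.scaleBy (unitScale P k) (unitScale_pos P k)) k N,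
                χ (rescaleVec (unitScale_pos P k) A') (rescaleScalar (unitScale_pos P k) φ')
                  * Real.exp
                      (-(a * (P.L : ℝ) ^ ((P.d : ℤ) - 2) / 2)
                          * ∑ y : Site (P.scaleBy (unitScale P k) (unitScale_pos P k)) (k + 1),
                              ‖toSite B' y - linAvg (toSite A') y‖ ^ 2
                        - a * (P.L : ℝ) ^ ((P.d : ℤ) - 2) / 2
                          * ∑ y : Site (P.scaleBy (unitScale P k) (unitScale_pos P k)) (k + 1),
                              ‖ψ' y - avgQ (P := P.scaleBy (unitScale P k) (unitScale_pos P k))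
                                (C.scaleBy P.d (unitScale P k)) (extRescale (unitScale_pos P k) ext A') φ' y‖ ^ 2
                        - S (rescaleVec (unitScale_pos P k) A') (rescaleScalar (unitScale_pos P k) φ')) := by
  rw [doubleRTk_rescale (unitScale_pos P k) C a (rescaleVec_extRescale (unitScale_pos P k) ext) χ S B' ψ']
  simp only [stepExponent, unit_prec_succ]
  ring

/-- **(3.38) p. 619 — the `(k+1)`-st step integral of (3.37) after the rescaling to the unit lattice.**  Let the k-th
action have the form (3.30), `S^{(k),L^kε}(A, φ) = −log Z_k − log Z_k(A^{(k),ε}) + ½⟨A, Δ^{(k),L^kε}A⟩ +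
½⟨φ, Δ^{(k),L^kε}(A^{(k),ε})φ⟩ − 𝒫^{(k),L^kε}(A^{(k),ε}, φ) + E₀` (`hS`; `A^{(k),ε} = ext A`).  Then for unit-lattice block
fields `B′, ψ′` and their rescalings `(B, ψ) = (σB′, σψ′)` (1.22) to the `L^kε`-lattice, `σ = (L^kε)^{−(d−2)/2}`:
`χ_{k+1}(B)χ_{k+1}(ψ) · T^{L^kε}_{a,L}[T^{L^kε}_{a,L,A^{(k),ε}}[χ_k(A)χ_k(φ)exp(−S^{(k),L^kε}(A,φ))]](B, ψ) = display338(B′, ψ′)`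
— the printed right side with `const = rescaleConstK`, the pulled-back weights, the conjugated background
`A′ ↦ A^{(k)}` (`extRescale`), the rescaled charge `e·(L^kε)^{(4−d)/2}` (p. 607) and the pulled-back constituents
`⟨A′, Δ^{(k)}A′⟩ := ⟨σA′, Δ^{(k),L^kε}σA′⟩`, `Δ^{(k)}(·)`, `Z_k(·)`, `𝒫^{(k)}` (*"rescaling of … the propagators"*); `log Z_k`,
`E₀` unchanged.  PROVED (`doubleRTk_rescale` + `stepExponent_unit_330`). [cite: Balaban1982Higgs1, (3.38) p.619] -/
theorem eq338 (C : ChargeData N) (a : ℝ) (ext : VecField P k → VecField P 0)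
    (χk1 : VecField P (k + 1) → ScalarField P (k + 1) N → ℝ) (χk : VecField P k → ScalarField P k N → ℝ)
    {S : VecField P k → ScalarField P k N → ℝ} {logZk E₀ : ℝ} {logZkA : VecField P 0 → ℝ}
    {formA : VecField P k → ℝ} {formφ Pk : VecField P 0 → ScalarField P k N → ℝ}
    (hS : ∀ A φ, S A φ = action330 logZk (logZkA (ext A)) (formA A) (formφ (ext A) φ) (Pk (ext A) φ) E₀)
    (B' : VecField (P.scaleBy (unitScale P k) (unitScale_pos P k)) (k + 1))
    (ψ' : ScalarField (P.scaleBy (unitScale P k) (unitScale_pos P k)) (k + 1) N) :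
    χk1 (rescaleVec (unitScale_pos P k) B') (rescaleScalar (unitScale_pos P k) ψ')
        * doubleRTk C a ext (fun A φ => χk A φ * Real.exp (-S A φ))
            (rescaleVec (unitScale_pos P k) B') (rescaleScalar (unitScale_pos P k) ψ')
      = display338 (P.scaleBy (unitScale P k) (unitScale_pos P k)) k (C.scaleBy P.d (unitScale P k)) a
          (rescaleConstK P k N a (unitScale P k))
          (fun B ψ => χk1 (rescaleVec (unitScale_pos P k) B) (rescaleScalar (unitScale_pos P k) ψ))
          (fun A φ => χk (rescaleVec (unitScale_pos P k) A) (rescaleScalar (unitScale_pos P k) φ))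
          (extRescale (unitScale_pos P k) ext) logZk
          (fun Ab => logZkA (rescaleVec (unitScale_pos P k) Ab))
          (fun A => formA (rescaleVec (unitScale_pos P k) A))
          (fun Ab φ => formφ (rescaleVec (unitScale_pos P k) Ab) (rescaleScalar (unitScale_pos P k) φ))
          (fun Ab φ => Pk (rescaleVec (unitScale_pos P k) Ab) (rescaleScalar (unitScale_pos P k) φ)) E₀ B' ψ' := by
  have hS₁ : ∀ (A : VecField (P.scaleBy (unitScale P k) (unitScale_pos P k)) k)
      (φ : ScalarField (P.scaleBy (unitScale P k) (unitScale_pos P k)) k N),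
      S (rescaleVec (unitScale_pos P k) A) (rescaleScalar (unitScale_pos P k) φ)
        = action330 logZk (logZkA (rescaleVec (unitScale_pos P k) (extRescale (unitScale_pos P k) ext A)))
            (formA (rescaleVec (unitScale_pos P k) A))
            (formφ (rescaleVec (unitScale_pos P k) (extRescale (unitScale_pos P k) ext A))
              (rescaleScalar (unitScale_pos P k) φ))
            (Pk (rescaleVec (unitScale_pos P k) (extRescale (unitScale_pos P k) ext A))
              (rescaleScalar (unitScale_pos P k) φ)) E₀ := by
    intro A φ
    rw [rescaleVec_extRescale]
    exact hS _ _
  rw [doubleRTk_rescale (unitScale_pos P k) C a (rescaleVec_extRescale (unitScale_pos P k) ext) χk S B' ψ']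
  unfold display338
  rw [mul_comm (χk1 _ _) (rescaleConstK P k N a (unitScale P k) * _), mul_assoc, mul_assoc]
  congr 1
  rw [mul_comm]
  congr 1
  refine integral_congr_ae (Filter.Eventually.of_forall fun A => ?_)
  refine integral_congr_ae (Filter.Eventually.of_forall fun φ => ?_)
  beta_reduce
  rw [stepExponent_unit_330 (unit_mesh_k P k) (C.scaleBy P.d (unitScale P k)) a
    (extRescale (unitScale_pos P k) ext)
    (S := fun A φ => S (rescaleVec (unitScale_pos P k) A) (rescaleScalar (unitScale_pos P k) φ))
    (logZk := logZk) (E₀ := E₀) (logZkA := fun Ab => logZkA (rescaleVec (unitScale_pos P k) Ab))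
    (formA := fun A => formA (rescaleVec (unitScale_pos P k) A))
    (formφ := fun Ab φ => formφ (rescaleVec (unitScale_pos P k) Ab) (rescaleScalar (unitScale_pos P k) φ))
    (Pk := fun Ab φ => Pk (rescaleVec (unitScale_pos P k) Ab) (rescaleScalar (unitScale_pos P k) φ)) hS₁]

/-- **(3.37) ⇝ (3.38) at the level of the `dB dψ`-integral**: the right side of (3.37) without the factor
`exp(Σ_{j<k} O(1)(L^jε)^{κ₀}|T_ε|)`, i.e. `∫dB∫dψ χ_{k+1}(B)χ_{k+1}(ψ)·T[T[χ_kχ_k e^{−S^{(k)}}]](B, ψ)` over the block fields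
of the `L^kε`-lattice, equals `σ^{|bonds of T^{(k+1)}| + N|T^{(k+1)}|}` times the integral of (3.38) over the unit-lattice
block fields `B′, ψ′` (`σ = (L^kε)^{−(d−2)/2}`, the Jacobian of (1.22) for the block fields). PROVED. [cite: Balaban1982Higgs1, (3.37)–(3.38) p.618–619] -/
theorem integral337_eq_integral338 (C : ChargeData N) (a : ℝ) (ext : VecField P k → VecField P 0)
    (χk1 : VecField P (k + 1) → ScalarField P (k + 1) N → ℝ) (χk : VecField P k → ScalarField P k N → ℝ)
    {S : VecField P k → ScalarField P k N → ℝ} {logZk E₀ : ℝ} {logZkA : VecField P 0 → ℝ}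
    {formA : VecField P k → ℝ} {formφ Pk : VecField P 0 → ScalarField P k N → ℝ}
    (hS : ∀ A φ, S A φ = action330 logZk (logZkA (ext A)) (formA A) (formφ (ext A) φ) (Pk (ext A) φ) E₀) :
    ∫ Ψ : VecField P (k + 1) × ScalarField P (k + 1) N,
        χk1 Ψ.1 Ψ.2 * doubleRTk C a ext (fun A φ => χk A φ * Real.exp (-S A φ)) Ψ.1 Ψ.2
      = ((unitScale P k) ^ (((P.d : ℝ) - 2) / 2))
            ^ (Fintype.card (PBond P (k + 1)) + N * Fintype.card (Site P (k + 1)))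
          * ∫ Ψ' : VecField (P.scaleBy (unitScale P k) (unitScale_pos P k)) (k + 1)
                × ScalarField (P.scaleBy (unitScale P k) (unitScale_pos P k)) (k + 1) N,
              display338 (P.scaleBy (unitScale P k) (unitScale_pos P k)) k (C.scaleBy P.d (unitScale P k)) a
                (rescaleConstK P k N a (unitScale P k))
                (fun B ψ => χk1 (rescaleVec (unitScale_pos P k) B) (rescaleScalar (unitScale_pos P k) ψ))
                (fun A φ => χk (rescaleVec (unitScale_pos P k) A) (rescaleScalar (unitScale_pos P k) φ))
                (extRescale (unitScale_pos P k) ext) logZk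
                (fun Ab => logZkA (rescaleVec (unitScale_pos P k) Ab))
                (fun A => formA (rescaleVec (unitScale_pos P k) A))
                (fun Ab φ => formφ (rescaleVec (unitScale_pos P k) Ab) (rescaleScalar (unitScale_pos P k) φ))
                (fun Ab φ => Pk (rescaleVec (unitScale_pos P k) Ab) (rescaleScalar (unitScale_pos P k) φ)) E₀
                Ψ'.1 Ψ'.2 := by
  have hσ : 0 < (unitScale P k) ^ (((P.d : ℝ) - 2) / 2) := Real.rpow_pos_of_pos (unitScale_pos P k) _
  have hn : 0 < ((unitScale P k) ^ (((P.d : ℝ) - 2) / 2))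
      ^ (Fintype.card (PBond P (k + 1)) + N * Fintype.card (Site P (k + 1))) := pow_pos hσ _
  have h := integral_cutoff_doubleRTk_rescale (unitScale_pos P k) C a ext χk1
    (fun A φ => χk A φ * Real.exp (-S A φ))
  simp_rw [eq338 C a ext χk1 χk hS] at h
  rw [h, abs_of_pos (inv_pos.mpr hn), ← mul_assoc, mul_inv_cancel₀ hn.ne', one_mul]

end Display338

end Literature.MathematicalPhysics.QuantumFieldTheory.Balaban1983to89.B1Eq338Display
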